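import Literature.Analysis.FluidPDE.MikadoHeatResidual
import Literature.Analysis.FluidPDE.MikadoSpaceTime
import HarnessLib

/-!
# The cascade residual of one Coiculescu–Palasek level: `R̄_{k-1}`, its pressure potential,
# `(∂ₜ - Δ) v̄_{k-1} = div (∂ₜ - Δ)R̄_{k-1} - ∇(∂ₜ - Δ)Q̄_{k-1}`, and `∂ₜR̄_{k-1} + 𝒩_{k,1} = 0`

Analysis/FluidPDE support file (definitions with proved API; no named facts) on the discharge path of
the principal-parts hypothesis `hA` of
`Literature.Barriers.NavierStokesRegularity.CriticalDataSmoothNonuniqueness_of_principalParts_of_perturbationLe`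
(M. P. Coiculescu, S. Palasek, Invent. Math. 244 (2025), arXiv:2503.14699). Prop. 4.1 (proof):
"`R̄_k = ½N_{k+1}⁻²∑_j A_{j,k+1}|η_j|² e^{-2|η_j|²N_{k+1}²t} a²_{j,k+1} θ_j⊗θ_j` … constructed so that
`ℙ div R̄_k = v̄_k`", "`𝒩_{k,1} = ∑_j A_{j,k}|η_j|⁴ e^{-2|η_j|²N_k²t} a²_{j,k} θ_j⊗θ_j`", "`F₂⁽¹⁾ = ∑_{k odd} ΔR̄_k`",
"it is a trivial calculation from the definitions that `∂ₜR̄_k + 𝒩_{k+1,1}` identically vanishes". Since the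
tree's classical Navier–Stokes form carries an honest pressure, the Leray projector in `v̄ = ℙ div R̄` is
written out: `ℙ div G = div G - ∇q_G` with the explicit scalar potential
`CP25.pressurePot G = ∑_{a,b} ∂_a∂_bΔ⁻¹ G_{ab}` (`gradient_pressurePot`, `lerayTensorDiv_eq_sub_gradient`).
For the data `I : CP25.IterData` (`h : I.Admissible`) and every level `k` (pairing the heat level `k` with
the cascade level `k-1`, `CP25.IterData.cascadePrev`):

* `CP25.IterData.selfTensor k j = a²_{j,k} θ_j⊗θ_j`, `Gprev`/`cprev` (the cascade tensor and coefficient one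
  level down, `0` at `k = 0`), `Rbar k t = R̄_{k-1}(t)`, `Qbar k t` (its pressure potential), and their
  time derivatives / Laplacians `RbarDt`, `RbarLap`, `QbarDt`, `QbarLap`; `N1 k t = 𝒩_{k,1}(t)` in the tree's
  normalisation (`∑_j e^{-2 rate t} rate² A_{j,k} N_k⁻⁴ a²θ⊗θ`);
* **`cascadePrev_eq`**: `v̄_{k-1}(t) = div R̄_{k-1}(t) - ∇Q̄_{k-1}(t)`; **`cascadeDt_eq`**, **`laplacian_cascadePrev`**:
  the same for `∂ₜ` and `Δ` (so `(∂ₜ - Δ)v̄ = div (∂ₜ - Δ)R̄ - ∇(∂ₜ - Δ)Q̄`);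
* **`tensorDiv_N1_eq_neg`**: `div 𝒩_{k,1}(t) = -div ∂ₜR̄_{k-1}(t)` for every `k` (for `k ≥ 1` the tensors
  themselves cancel, `RbarDt_add_N1`; at `k = 0`, `R̄_{-1} = 0` and `𝒩_{0,1}` is constant in `x`);
* symmetry, smoothness and crude all-orders `HasLiftDerivBounds` of all these tensors and potentials
  (for the series over levels), and the generic calculus: `laplacian_tensorDiv`, `laplacian_gradient`,
  `gradient_finset_sum_smul`, `hasLiftDerivBounds_pressurePot` (Hölder loss `L^α`).

## Mathlib / tree search

Tree: `lerayTensorDiv_eq`, `rieszGradDiv`, `rieszHessian_finset_sum_smul`, `czConst_spec`,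
`eContDiffHolderNorm_le_of_hasLiftDerivBounds` (`LerayTensorHolder`), `BDSV.rieszHessian(_eq_partialDeriv_invLaplacian_partialDeriv)`,
`BDSV.gradient_apply'`, `Torus.partialDeriv_laplacian`, `CP25.laplacian_add_apply` etc. (`MikadoHeatResidual`), the
cascade API of `MikadoCascadeBlocks`, `CP25.IterData.Wprev` (`MikadoSpaceTime`).

## On the hypothesis `h : I.Admissible`

`CP25.IterData.Admissible I` (a `structure … : Prop` of `MikadoDataIteration`) bundles the standing
HYPOTHESES on the abstract inputs `I`; the theorems below take `h : I.Admissible` as a section hypothesis.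
It is not a named fact: it is PROVED for the paper's concrete inputs in `CP25.admissible_mkIter` (`MikadoInputs`).

## References

* M. P. Coiculescu, S. Palasek, Invent. Math. 244 (2025) 165–219, doi:10.1007/s00222-025-01396-z,
  arXiv:2503.14699: Def. 3.10, §4.1 (Prop. 4.1: `R̄_k`, `𝒩_{k,1}`, `F₂`, `F₃`). [CoiculescuPalasek2025]
* T. Buckmaster, C. De Lellis, L. Székelyhidi Jr., V. Vicol, CPAM 72 (2019), App. C Prop. C.1 (the Calderón–Zygmund
  bound used for the pressure potential). [BuckmasterEtAl2018]
-/

noncomputable section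

open MeasureTheory Set Filter Function
open _root_.Topology
open scoped BigOperators ContDiff ENNReal NNReal

namespace Literature.Analysis.FluidPDE

namespace CP25

open Literature.Analysis.FunctionSpaces Literature.Analysis.FunctionSpaces.Torus

/-! ## Generic: entrywise Laplacian of a tensor, the pressure potential of `ℙ div`, gradients -/

section Generic

variable {G : UnitAddTorus (Fin 3) → (Fin 3 → Fin 3 → ℝ)}

/-- The entrywise Laplacian of a tensor field. [folklore] -/
def tensorLap (G : UnitAddTorus (Fin 3) → (Fin 3 → Fin 3 → ℝ)) (y : UnitAddTorus (Fin 3)) (a b : Fin 3) : ℝ :=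
  Torus.laplacian (fun z => G z a b) y

/-- **The pressure potential of `ℙ div G`**: `q_G = ∑_{a,b} ∂_a∂_bΔ⁻¹ G_{ab}`, so that `ℙ div G = div G - ∇q_G`.
[cite: CoiculescuPalasek2025, Def. 3.10 (`ℙ div`)] -/
def pressurePot (G : UnitAddTorus (Fin 3) → (Fin 3 → Fin 3 → ℝ)) (x : UnitAddTorus (Fin 3)) : ℝ :=
  ∑ a, ∑ b, BDSV.rieszHessian a b (fun y => G y a b) x

/-- Entries of a smooth tensor field are smooth. [folklore] -/
theorem isSmooth_entry (hG : IsSmooth G) (a b : Fin 3) : IsSmooth fun y => G y a b :=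
  (contDiff_pi.1 ((contDiff_pi.1 hG) a)) b

/-- The entrywise Laplacian of a smooth tensor is smooth. [folklore] -/
theorem isSmooth_tensorLap (hG : IsSmooth G) : IsSmooth (tensorLap G) :=
  contDiff_pi.2 fun a => contDiff_pi.2 fun b => (isSmooth_entry hG a b).laplacian

/-- The pressure potential of a smooth tensor is smooth. [folklore] -/
theorem isSmooth_pressurePot (hG : IsSmooth G) : IsSmooth (pressurePot G) :=
  Torus.isSmooth_finset_sum _ fun a _ => Torus.isSmooth_finset_sum _ fun b _ =>
    BDSV.isSmooth_rieszHessian (isSmooth_entry hG a b) a b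

/-- **`∂_c q_G = (rieszGradDiv (div G))_c`**: the potential generates the gradient part of the Leray projection.
[cite: CoiculescuPalasek2025, Def. 3.10 (`ℙ div`)] -/
theorem partialDeriv_pressurePot (hG : IsSmooth G) (c : Fin 3) (x : UnitAddTorus (Fin 3)) :
    Torus.partialDeriv c (pressurePot G) x = rieszGradDiv (tensorDiv G) x c := by
  have hE := isSmooth_entry hG
  have hR : ∀ a b, IsSmooth (BDSV.rieszHessian a b fun y => G y a b) := fun a b => BDSV.isSmooth_rieszHessian (hE a b) a b
  -- derivative of the double sum
  have h1 : Torus.partialDeriv c (pressurePot G) x = ∑ a, ∑ b, Torus.partialDeriv c (BDSV.rieszHessian a b fun y => G y a b) x := by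
    unfold pressurePot
    rw [partialDeriv_finset_sum _ (fun a _ => (Torus.isSmooth_finset_sum _ fun b _ => hR a b).isContDiff (by simp))]
    refine Finset.sum_congr rfl fun a _ => ?_
    exact partialDeriv_finset_sum _ (fun b _ => (hR a b).isContDiff (by simp)) c x
  -- `∂_c (∂_a∂_bΔ⁻¹ G_ab) = ∂_c∂_aΔ⁻¹(∂_b G_ab)`
  have h2 : ∀ a b, Torus.partialDeriv c (BDSV.rieszHessian a b fun y => G y a b) x =
      BDSV.rieszHessian c a (Torus.partialDeriv b fun y => G y a b) x := by
    intro a b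
    rw [show BDSV.rieszHessian a b (fun y => G y a b) = fun y => Torus.partialDeriv a (invLaplacian (Torus.partialDeriv b fun y => G y a b)) y
      from funext fun y => BDSV.rieszHessian_eq_partialDeriv_invLaplacian_partialDeriv (hE a b) a b y]
    rfl
  rw [h1]
  simp only [h2]
  -- assemble the row divergence
  rw [rieszGradDiv, WithLp.ofLp_toLp]
  dsimp only
  refine Finset.sum_congr rfl fun a _ => ?_
  rw [show (fun y => tensorDiv G y a) = fun y => ∑ b ∈ Finset.univ, (1 : ℝ) * Torus.partialDeriv b (fun z => G z a b) y from by
      funext y; simp [tensorDiv_apply],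
    rieszHessian_finset_sum_smul Finset.univ (fun _ => (1 : ℝ)) (fun b _ => (hE a b).partialDeriv b) c a x]
  simp

/-- **`∇q_G = rieszGradDiv (div G)`.** [cite: CoiculescuPalasek2025, Def. 3.10] -/
theorem gradient_pressurePot (hG : IsSmooth G) (x : UnitAddTorus (Fin 3)) :
    Torus.gradient (pressurePot G) x = rieszGradDiv (tensorDiv G) x := by
  ext c
  rw [BDSV.gradient_apply' ((isSmooth_pressurePot hG).isContDiff (by simp)), partialDeriv_pressurePot hG]

/-- **`ℙ div G = div G - ∇q_G`.** [cite: CoiculescuPalasek2025, Def. 3.10] -/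
theorem lerayTensorDiv_eq_sub_gradient (hG : IsSmooth G) (x : UnitAddTorus (Fin 3)) :
    lerayTensorDiv G x = tensorDiv G x - Torus.gradient (pressurePot G) x := by
  rw [lerayTensorDiv_eq, gradient_pressurePot hG]

/-- **`Δ(div G) = div(ΔG)`** (entrywise Laplacian). [folklore] -/
theorem laplacian_tensorDiv (hG : IsSmooth G) (x : UnitAddTorus (Fin 3)) :
    Torus.laplacian (tensorDiv G) x = tensorDiv (tensorLap G) x := by
  have hE := isSmooth_entry hG
  ext i
  rw [Torus.laplacian_apply_coord (isSmooth_tensorDiv hG) x i, tensorDiv_apply]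
  rw [show (fun y => tensorDiv G y i) = fun y => ∑ b ∈ Finset.univ, (1 : ℝ) • Torus.partialDeriv b (fun z => G z i b) y from by
      funext y; simp [tensorDiv_apply],
    laplacian_finset_sum_smul Finset.univ _ (fun b _ => (hE i b).partialDeriv b) x]
  refine Finset.sum_congr rfl fun b _ => ?_
  rw [one_smul, ← Torus.partialDeriv_laplacian (hE i b) b x]
  rfl

/-- **`Δ(∇q) = ∇(Δq)`.** [folklore] -/
theorem laplacian_gradient {q : UnitAddTorus (Fin 3) → ℝ} (hq : IsSmooth q) (x : UnitAddTorus (Fin 3)) :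
    Torus.laplacian (Torus.gradient q) x = Torus.gradient (Torus.laplacian q) x := by
  ext i
  rw [Torus.laplacian_apply_coord hq.gradient x i, BDSV.gradient_apply' (hq.laplacian.isContDiff (by simp)),
    show (fun y => Torus.gradient q y i) = Torus.partialDeriv i q from funext fun y => BDSV.gradient_apply' (hq.isContDiff (by simp)) y i,
    Torus.partialDeriv_laplacian hq i x]

/-- The gradient of a finite weighted sum of smooth functions. [folklore] -/
theorem gradient_finset_sum_smul {ι : Type*} (s : Finset ι) (c : ι → ℝ) {f : ι → UnitAddTorus (Fin 3) → ℝ}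
    (hf : ∀ i ∈ s, IsSmooth (f i)) (x : UnitAddTorus (Fin 3)) :
    Torus.gradient (fun y => ∑ i ∈ s, c i * f i y) x = ∑ i ∈ s, c i • Torus.gradient (f i) x := by
  have hsm : IsSmooth fun y => ∑ i ∈ s, c i * f i y := Torus.isSmooth_finset_sum s fun i hi => (hf i hi).smul (c i)
  ext l
  rw [BDSV.gradient_apply' (hsm.isContDiff (by simp)), WithLp.ofLp_sum, Finset.sum_apply,
    partialDeriv_finset_sum s (f := fun i y => c i * f i y) (fun i hi => ((hf i hi).smul (c i)).isContDiff (by simp))]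
  refine Finset.sum_congr rfl fun i hi => ?_
  rw [WithLp.ofLp_smul, Pi.smul_apply, BDSV.gradient_apply' ((hf i hi).isContDiff (by simp)), smul_eq_mul,
    Torus.partialDeriv_const_mul_apply ((hf i hi).isContDiff (by simp))]

/-- The pressure potential of a finite weighted sum. [folklore] -/
theorem pressurePot_finset_sum_smul {ι : Type*} (s : Finset ι) (c : ι → ℝ) {Gi : ι → UnitAddTorus (Fin 3) → (Fin 3 → Fin 3 → ℝ)}
    (hG : ∀ i ∈ s, IsSmooth (Gi i)) (x : UnitAddTorus (Fin 3)) :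
    pressurePot (fun y a b => ∑ i ∈ s, c i * Gi i y a b) x = ∑ i ∈ s, c i * pressurePot (Gi i) x := by
  simp only [pressurePot]
  have h1 : ∀ a b, BDSV.rieszHessian a b (fun y => ∑ i ∈ s, c i * Gi i y a b) x =
      ∑ i ∈ s, c i * BDSV.rieszHessian a b (fun y => Gi i y a b) x :=
    fun a b => rieszHessian_finset_sum_smul s c (f := fun i y => Gi i y a b) (fun i hi => isSmooth_entry (hG i hi) a b) a b x
  simp only [h1, Finset.mul_sum]
  calc ∑ a, ∑ b, ∑ i ∈ s, c i * BDSV.rieszHessian a b (fun y => Gi i y a b) x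
      = ∑ a, ∑ i ∈ s, ∑ b, c i * BDSV.rieszHessian a b (fun y => Gi i y a b) x :=
        Finset.sum_congr rfl fun a _ => Finset.sum_comm
    _ = ∑ i ∈ s, ∑ a, ∑ b, c i * BDSV.rieszHessian a b (fun y => Gi i y a b) x := Finset.sum_comm

/-- The entrywise Laplacian of a finite weighted sum. [folklore] -/
theorem tensorLap_finset_sum_smul {ι : Type*} (s : Finset ι) (c : ι → ℝ) {Gi : ι → UnitAddTorus (Fin 3) → (Fin 3 → Fin 3 → ℝ)}
    (hG : ∀ i ∈ s, IsSmooth (Gi i)) (y : UnitAddTorus (Fin 3)) (a b : Fin 3) :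
    tensorLap (fun z a b => ∑ i ∈ s, c i * Gi i z a b) y a b = ∑ i ∈ s, c i * tensorLap (Gi i) y a b := by
  unfold tensorLap
  have := laplacian_finset_sum_smul s c (f := fun i z => Gi i z a b) (fun i hi => isSmooth_entry (hG i hi) a b) y
  simp only [smul_eq_mul] at this
  exact this

/-! ### Bounds -/

/-- The entrywise Laplacian in the currency. [folklore] -/
theorem hasLiftDerivBounds_tensorLap {n : ℕ} {C L : ℝ} (hG : HasLiftDerivBounds (n + 2) G C L) (hL : 0 ≤ L) :
    HasLiftDerivBounds n (tensorLap G) (3 * (C * L ^ 2)) L := by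
  refine HasLiftDerivBounds.of_pi (fun a => HasLiftDerivBounds.of_pi (fun b => ?_) (by have := hG.nonneg; positivity) hL)
    (by have := hG.nonneg; positivity) hL
  exact IterData.Admissible.hasLiftDerivBounds_laplacian' ((hG.pi_apply a).pi_apply b) hL

variable {α : ℝ≥0}

/-- **One second Riesz transform of a scalar in the currency**: `HasLiftDerivBounds (n+1) f C L`, `1 ≤ L`, `0 < α < 1`
give `‖Dᵐ(∂_c∂_aΔ⁻¹ f ∘ proj)‖ ≤ K_n C L^α Lᵐ` for `m ≤ n` (the scalar form of
`norm_iteratedFDeriv_lift_rieszHessian_le`). [cite: BuckmasterEtAl2018, App. C Prop. C.1] -/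
theorem norm_iteratedFDeriv_lift_rieszHessian_scalar_le (hα : 0 < α) (hα1 : α < 1) {n : ℕ}
    {f : UnitAddTorus (Fin 3) → ℝ} {C L : ℝ} (hf : HasLiftDerivBounds (n + 1) f C L)
    (hL : 1 ≤ L) (c a : Fin 3) {m : ℕ} (hm : m ≤ n) (y : EuclideanSpace ℝ (Fin 3)) :
    ‖iteratedFDeriv ℝ m (lift (BDSV.rieszHessian c a f)) y‖ ≤ czConstSup α hα hα1 n * C * L ^ (α : ℝ) * L ^ m := by
  have hfm : HasLiftDerivBounds (m + 1) f C L := hf.of_le (by omega)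
  have hC := hf.nonneg
  have hL0 : 0 < L := lt_of_lt_of_le one_pos hL
  have hH := eContDiffHolderNorm_le_of_hasLiftDerivBounds hfm hL hα1.le
  have hCZ := czConst_spec hα hα1 m c a hfm.isSmooth
  have hB0 : 0 ≤ ((m : ℝ) + 4) * C * L ^ m * L ^ (α : ℝ) := by positivity
  have hR : Torus.eContDiffHolderNorm m α (BDSV.rieszHessian c a f) ≤
      ENNReal.ofReal (czConst α hα hα1 m * (((m : ℝ) + 4) * C * L ^ m * L ^ (α : ℝ))) := by
    refine hCZ.trans ?_
    rw [ENNReal.ofReal_mul (NNReal.coe_nonneg _), ENNReal.ofReal_coe_nnreal]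
    exact mul_le_mul' le_rfl hH
  have h := norm_iteratedFDeriv_lift_le_of_eContDiffHolderNorm_le (by positivity) hR le_rfl y
  refine h.trans ?_
  have hK := mul_czConst_le_czConstSup hα hα1 hm
  have : 0 ≤ C * L ^ m * L ^ (α : ℝ) := by positivity
  calc (czConst α hα hα1 m : ℝ) * (((m : ℝ) + 4) * C * L ^ m * L ^ (α : ℝ))
      = (((m : ℝ) + 4) * czConst α hα hα1 m) * (C * L ^ m * L ^ (α : ℝ)) := by ring
    _ ≤ czConstSup α hα hα1 n * (C * L ^ m * L ^ (α : ℝ)) := mul_le_mul_of_nonneg_right hK this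
    _ = czConstSup α hα hα1 n * C * L ^ (α : ℝ) * L ^ m := by ring

/-- **The pressure potential in the currency, with Hölder loss**: `HasLiftDerivBounds n q_G (9 K_n C L^α) L` from
`HasLiftDerivBounds (n+1) G C L`, `1 ≤ L`. [cite: BuckmasterEtAl2018, App. C Prop. C.1] -/
theorem hasLiftDerivBounds_pressurePot (hα : 0 < α) (hα1 : α < 1) {n : ℕ} {C L : ℝ}
    (hG : HasLiftDerivBounds (n + 1) G C L) (hL : 1 ≤ L) :
    HasLiftDerivBounds n (pressurePot G) (9 * (czConstSup α hα hα1 n * C * L ^ (α : ℝ))) L := by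
  have hL0 : 0 ≤ L := le_trans zero_le_one hL
  have hterm : ∀ a ∈ (Finset.univ : Finset (Fin 3)), ∀ b ∈ (Finset.univ : Finset (Fin 3)),
      HasLiftDerivBounds n (BDSV.rieszHessian a b fun y => G y a b) (czConstSup α hα hα1 n * C * L ^ (α : ℝ)) L :=
    fun a _ b _ => ⟨BDSV.isSmooth_rieszHessian ((hG.pi_apply a).pi_apply b).isSmooth a b, fun m hm y =>
      norm_iteratedFDeriv_lift_rieszHessian_scalar_le hα hα1 ((hG.pi_apply a).pi_apply b) hL a b hm y⟩
  have hrow : ∀ a ∈ (Finset.univ : Finset (Fin 3)),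
      HasLiftDerivBounds n (fun x => ∑ b, BDSV.rieszHessian a b (fun y => G y a b) x) (3 * (czConstSup α hα hα1 n * C * L ^ (α : ℝ))) L := by
    intro a ha
    have hs := HasLiftDerivBounds.sum Finset.univ (hterm a ha) hL0
    simpa [Finset.sum_const, Finset.card_univ, Fintype.card_fin] using hs
  have hs := HasLiftDerivBounds.sum Finset.univ hrow hL0
  have h9 : (∑ _a : Fin 3, 3 * (czConstSup α hα hα1 n * C * L ^ (α : ℝ))) = 9 * (czConstSup α hα hα1 n * C * L ^ (α : ℝ)) := by
    simp [Finset.sum_const, Finset.card_univ, Fintype.card_fin]; ring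
  rw [h9] at hs
  exact hs

end Generic

/-! ## The cascade residual of level `k` -/

namespace IterData

variable (I : IterData)

/-- `a²_{j,k} θ_j⊗θ_j` at level `k` (so that `ampSqTensor k j = selfTensor (k+1) j`). [cite: CoiculescuPalasek2025, Def. 3.10] -/
def selfTensor (k : ℕ) (j : Fin 6) (x : UnitAddTorus (Fin 3)) (a b : Fin 3) : ℝ :=
  I.amp k j x ^ 2 * (((nashDir j a : ℝ)) * (nashDir j b : ℝ))

/-- The cascade tensor one level down: `Gprev (k+1) j = a²_{j,k+1}θ_j⊗θ_j`, `Gprev 0 j = 0`. [cite: CoiculescuPalasek2025, §4.1 (`R̄_k`)] -/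
def Gprev : ℕ → Fin 6 → UnitAddTorus (Fin 3) → (Fin 3 → Fin 3 → ℝ)
  | 0 => fun _ _ _ _ => 0
  | k + 1 => I.ampSqTensor k

/-- The cascade coefficient one level down: `cprev (k+1) j = cascadeCoeff k j`, `cprev 0 j = 0`. [cite: CoiculescuPalasek2025, §4.1] -/
def cprev : ℕ → Fin 6 → ℝ
  | 0 => fun _ => 0
  | k + 1 => I.cascadeCoeff k

/-- **`R̄_{k-1}(t) = ∑_j e^{-2rate_{k,j}t} c_j a²_{j,k}θ_j⊗θ_j`** (`= 0` for `k = 0`). [cite: CoiculescuPalasek2025, Prop. 4.1 (`R̄_k`)] -/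
def Rbar (k : ℕ) (t : ℝ) (x : UnitAddTorus (Fin 3)) (a b : Fin 3) : ℝ :=
  ∑ j, (Real.exp (-(2 * I.rate k j * t)) * I.cprev k j) * I.Gprev k j x a b

/-- `∂ₜ R̄_{k-1}(t)`. [cite: CoiculescuPalasek2025, Prop. 4.1] -/
def RbarDt (k : ℕ) (t : ℝ) (x : UnitAddTorus (Fin 3)) (a b : Fin 3) : ℝ :=
  ∑ j, ((-(2 * I.rate k j) * Real.exp (-(2 * I.rate k j * t))) * I.cprev k j) * I.Gprev k j x a b

/-- `Δ R̄_{k-1}(t)` (entrywise). [cite: CoiculescuPalasek2025, Prop. 4.1 (`F₂`)] -/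
def RbarLap (k : ℕ) (t : ℝ) (x : UnitAddTorus (Fin 3)) (a b : Fin 3) : ℝ :=
  ∑ j, (Real.exp (-(2 * I.rate k j * t)) * I.cprev k j) * tensorLap (I.Gprev k j) x a b

/-- **The pressure potential `Q̄_{k-1}(t)` of `v̄_{k-1}(t)`**: `∑_j e^{-2rate t} c_j q_{a²θθ}`. [cite: CoiculescuPalasek2025, Def. 3.10 (`ℙ div`)] -/
def Qbar (k : ℕ) (t : ℝ) (x : UnitAddTorus (Fin 3)) : ℝ :=
  ∑ j, (Real.exp (-(2 * I.rate k j * t)) * I.cprev k j) * pressurePot (I.Gprev k j) x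

/-- `∂ₜ Q̄_{k-1}(t)`. [cite: CoiculescuPalasek2025, Def. 3.10] -/
def QbarDt (k : ℕ) (t : ℝ) (x : UnitAddTorus (Fin 3)) : ℝ :=
  ∑ j, ((-(2 * I.rate k j) * Real.exp (-(2 * I.rate k j * t))) * I.cprev k j) * pressurePot (I.Gprev k j) x

/-- `Δ Q̄_{k-1}(t)`. [cite: CoiculescuPalasek2025, Def. 3.10] -/
def QbarLap (k : ℕ) (t : ℝ) (x : UnitAddTorus (Fin 3)) : ℝ :=
  ∑ j, (Real.exp (-(2 * I.rate k j * t)) * I.cprev k j) * Torus.laplacian (pressurePot (I.Gprev k j)) x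

/-- **`𝒩_{k,1}(t) = ∑_j e^{-2rate_{k,j}t} rate²_{k,j} A_{j,k} N_k⁻⁴ a²_{j,k}θ_j⊗θ_j`** (the mean part of
`v^p_k⊗v^p_k`, with `v^p_{j,k} = rate_{k,j} a_{j,k}Ψ⁰_{j,k}`). [cite: CoiculescuPalasek2025, Prop. 4.1 (`𝒩_{k,1}`)] -/
def N1 (k : ℕ) (t : ℝ) (x : UnitAddTorus (Fin 3)) (a b : Fin 3) : ℝ :=
  ∑ j, (Real.exp (-(2 * I.rate k j * t)) * (I.rate k j ^ 2 * I.A k j * ((I.N k : ℝ) ^ 4)⁻¹)) * I.selfTensor k j x a b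

/-- `W'_{j,k} = c_j ℙ div Gprev`. [cite: CoiculescuPalasek2025, Def. 3.10] -/
theorem Wprev_eq (k : ℕ) (j : Fin 6) (x : UnitAddTorus (Fin 3)) : I.Wprev k j x = I.cprev k j • lerayTensorDiv (I.Gprev k j) x := by
  cases k with
  | zero => simp [Wprev, cprev]
  | succ k => rfl

/-- `ampSqTensor k j = selfTensor (k+1) j`. [folklore] -/
theorem ampSqTensor_eq_selfTensor (k : ℕ) (j : Fin 6) : I.ampSqTensor k j = I.selfTensor (k + 1) j := rfl

/-- The tensors `θ_j⊗θ_j` are symmetric: `selfTensor` is symmetric. [folklore] -/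
theorem selfTensor_symm (k : ℕ) (j : Fin 6) (x : UnitAddTorus (Fin 3)) (a b : Fin 3) :
    I.selfTensor k j x a b = I.selfTensor k j x b a := by
  unfold selfTensor; ring

/-- `Gprev` is symmetric. [folklore] -/
theorem Gprev_symm (k : ℕ) (j : Fin 6) (x : UnitAddTorus (Fin 3)) (a b : Fin 3) : I.Gprev k j x a b = I.Gprev k j x b a := by
  cases k with
  | zero => rfl
  | succ k => exact I.selfTensor_symm (k + 1) j x a b

/-- `R̄` is symmetric. [cite: CoiculescuPalasek2025, Prop. 4.1] -/
theorem Rbar_symm (k : ℕ) (t : ℝ) (x : UnitAddTorus (Fin 3)) (a b : Fin 3) : I.Rbar k t x a b = I.Rbar k t x b a := by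
  unfold Rbar; exact Finset.sum_congr rfl fun j _ => by rw [I.Gprev_symm k j x a b]

/-- `∂ₜR̄` is symmetric. [cite: CoiculescuPalasek2025, Prop. 4.1] -/
theorem RbarDt_symm (k : ℕ) (t : ℝ) (x : UnitAddTorus (Fin 3)) (a b : Fin 3) : I.RbarDt k t x a b = I.RbarDt k t x b a := by
  unfold RbarDt; exact Finset.sum_congr rfl fun j _ => by rw [I.Gprev_symm k j x a b]

/-- `𝒩_{k,1}` is symmetric. [cite: CoiculescuPalasek2025, Prop. 4.1] -/
theorem N1_symm (k : ℕ) (t : ℝ) (x : UnitAddTorus (Fin 3)) (a b : Fin 3) : I.N1 k t x a b = I.N1 k t x b a := by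
  unfold N1; exact Finset.sum_congr rfl fun j _ => by rw [I.selfTensor_symm k j x a b]

/-- `amp 0 j` is constant, hence so is `selfTensor 0 j`. [cite: CoiculescuPalasek2025, Def. 3.5 (`a_{j,0} = N₀δ_{j,1}`)] -/
theorem selfTensor_zero_const (j : Fin 6) (x y : UnitAddTorus (Fin 3)) (a b : Fin 3) :
    I.selfTensor 0 j x a b = I.selfTensor 0 j y a b := by
  simp [selfTensor, amp]

/-- At `k = 0` there is no cascade partner: `∂ₜR̄_{-1} = 0`. [folklore] -/
theorem RbarDt_zero (t : ℝ) (x : UnitAddTorus (Fin 3)) (a b : Fin 3) : I.RbarDt 0 t x a b = 0 := by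
  simp [RbarDt, cprev, Gprev]

namespace Admissible

variable {I} (h : I.Admissible)
include h

/-! ### Smoothness and bounds of the level-`k` cascade objects -/

/-- `Gprev k j` in the currency at scale `N_k`: amplitude `4(Camp_n N_k)²`, frequency `4 c_n N_k`, `c_n = c̄_n + cχ_n`.
[cite: CoiculescuPalasek2025, Prop. 3.13 (abounds)] -/
theorem hasLiftDerivBounds_Gprev (n k : ℕ) (j : Fin 6) :
    HasLiftDerivBounds n (I.Gprev k j) (4 * (I.cst.Camp n * I.N k) ^ 2)
      (4 * ((derivProfileMassSup (Fin 3) n + I.cst.cχ n) * I.N k)) := by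
  have hc : 0 ≤ (derivProfileMassSup (Fin 3) n + I.cst.cχ n) := by
    have := one_le_derivProfileMassSup (d := Fin 3) n; have := h.cχ_nonneg n; positivity
  cases k with
  | zero =>
    have hL : 0 ≤ 4 * ((derivProfileMassSup (Fin 3) n + I.cst.cχ n) * I.N 0) := by have := (h.N_pos' 0).le; positivity
    exact (hasLiftDerivBounds_zero (d := Fin 3) (F := Fin 3 → Fin 3 → ℝ) n hL).mono (by positivity) hL le_rfl
  | succ k =>
    have hb := h.hasLiftDerivBounds_ampSqTensor n k j
    refine hb.mono le_rfl (by have := h.Λf_nonneg n k; positivity) ?_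
    exact mul_le_mul_of_nonneg_left (h.Λf_le n k) (by norm_num)

/-- `Gprev k j` is smooth. [folklore] -/
theorem isSmooth_Gprev (k : ℕ) (j : Fin 6) : IsSmooth (I.Gprev k j) := (h.hasLiftDerivBounds_Gprev 0 k j).isSmooth

/-- `0 ≤ cprev ≤ 10π² N_k⁻²`. [cite: CoiculescuPalasek2025, §4.1] -/
theorem cprev_mem (k : ℕ) (j : Fin 6) : 0 ≤ I.cprev k j ∧ I.cprev k j ≤ 10 * Real.pi ^ 2 * (((I.N k : ℝ)) ^ 2)⁻¹ := by
  cases k with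
  | zero => exact ⟨le_rfl, by simp [cprev]; positivity⟩
  | succ k => exact ⟨h.cascadeCoeff_nonneg' k j, h.cascadeCoeff_le k j⟩

/-- `1 ≤ 4 c_n N_k` (the frequencies are `≥ 1`, as the Calderón–Zygmund bound wants). [folklore] -/
theorem one_le_freq (n k : ℕ) : 1 ≤ 4 * ((derivProfileMassSup (Fin 3) n + I.cst.cχ n) * I.N k) := by
  have h1 := one_le_derivProfileMassSup (d := Fin 3) n
  have h2 := h.cχ_nonneg n
  have h3 : (1 : ℝ) ≤ I.N k := by exact_mod_cast h.one_le_N k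
  nlinarith

/-- The pressure potential of `Gprev k j` in the currency (exponent `α = 1/2`). [cite: BuckmasterEtAl2018, App. C Prop. C.1] -/
theorem hasLiftDerivBounds_pressurePot_Gprev (n k : ℕ) (j : Fin 6) :
    HasLiftDerivBounds n (pressurePot (I.Gprev k j))
      (9 * (czConstSup (1 / 2) (by norm_num) (by norm_num) n * (4 * (I.cst.Camp (n + 1) * I.N k) ^ 2) *
        (4 * ((derivProfileMassSup (Fin 3) (n + 1) + I.cst.cχ (n + 1)) * I.N k)) ^ (((1 / 2 : ℝ≥0) : ℝ))))
      (4 * ((derivProfileMassSup (Fin 3) (n + 1) + I.cst.cχ (n + 1)) * I.N k)) :=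
  hasLiftDerivBounds_pressurePot (by norm_num) (by norm_num) (h.hasLiftDerivBounds_Gprev (n + 1) k j) (h.one_le_freq (n + 1) k)

/-- The pressure potential of `Gprev k j` is smooth. [folklore] -/
theorem isSmooth_pressurePot_Gprev (k : ℕ) (j : Fin 6) : IsSmooth (pressurePot (I.Gprev k j)) :=
  isSmooth_pressurePot (h.isSmooth_Gprev k j)

/-! ### The identities -/

/-- **`v̄_{k-1}(t) = div R̄_{k-1}(t) - ∇Q̄_{k-1}(t)`** (the Leray projector written out with the explicit
pressure potential). [cite: CoiculescuPalasek2025, Prop. 4.1 ("`ℙ div R̄_k = v̄_k`")] -/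
theorem cascadePrev_eq (k : ℕ) (t : ℝ) (x : UnitAddTorus (Fin 3)) :
    I.cascadePrev k t x = tensorDiv (I.Rbar k t) x - Torus.gradient (I.Qbar k t) x := by
  have hG : ∀ j ∈ (Finset.univ : Finset (Fin 6)), IsSmooth (I.Gprev k j) := fun j _ => h.isSmooth_Gprev k j
  have hP : ∀ j ∈ (Finset.univ : Finset (Fin 6)), IsSmooth (pressurePot (I.Gprev k j)) := fun j _ => h.isSmooth_pressurePot_Gprev k j
  rw [I.cascadePrev_eq k t x,
    show I.Rbar k t = fun y a b => ∑ j ∈ Finset.univ, (Real.exp (-(2 * I.rate k j * t)) * I.cprev k j) * I.Gprev k j y a b from rfl,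
    tensorDiv_finset_sum_smul Finset.univ _ hG x,
    show I.Qbar k t = fun y => ∑ j ∈ Finset.univ, (Real.exp (-(2 * I.rate k j * t)) * I.cprev k j) * pressurePot (I.Gprev k j) y from rfl,
    gradient_finset_sum_smul Finset.univ _ hP x, ← Finset.sum_sub_distrib]
  refine Finset.sum_congr rfl fun j _ => ?_
  rw [I.Wprev_eq, lerayTensorDiv_eq_sub_gradient (h.isSmooth_Gprev k j)]
  module

/-- **`∂ₜv̄_{k-1}(t) = div ∂ₜR̄_{k-1}(t) - ∇∂ₜQ̄_{k-1}(t)`** (the cascade part of `CP25.IterData.blockDt`). [cite: CoiculescuPalasek2025, Prop. 4.1] -/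
theorem cascadeDt_eq (k : ℕ) (t : ℝ) (x : UnitAddTorus (Fin 3)) :
    ∑ j, (-(2 * I.rate k j) * Real.exp (-(2 * I.rate k j * t))) • I.Wprev k j x =
      tensorDiv (I.RbarDt k t) x - Torus.gradient (I.QbarDt k t) x := by
  have hG : ∀ j ∈ (Finset.univ : Finset (Fin 6)), IsSmooth (I.Gprev k j) := fun j _ => h.isSmooth_Gprev k j
  have hP : ∀ j ∈ (Finset.univ : Finset (Fin 6)), IsSmooth (pressurePot (I.Gprev k j)) := fun j _ => h.isSmooth_pressurePot_Gprev k j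
  rw [show I.RbarDt k t = fun y a b => ∑ j ∈ Finset.univ, ((-(2 * I.rate k j) * Real.exp (-(2 * I.rate k j * t))) * I.cprev k j) * I.Gprev k j y a b from rfl,
    tensorDiv_finset_sum_smul Finset.univ _ hG x,
    show I.QbarDt k t = fun y => ∑ j ∈ Finset.univ, ((-(2 * I.rate k j) * Real.exp (-(2 * I.rate k j * t))) * I.cprev k j) * pressurePot (I.Gprev k j) y from rfl,
    gradient_finset_sum_smul Finset.univ _ hP x, ← Finset.sum_sub_distrib]
  refine Finset.sum_congr rfl fun j _ => ?_
  rw [I.Wprev_eq, lerayTensorDiv_eq_sub_gradient (h.isSmooth_Gprev k j)]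
  module

/-- `R̄(t)` is smooth in `x`. [folklore] -/
theorem isSmooth_Rbar (k : ℕ) (t : ℝ) : IsSmooth (I.Rbar k t) := by
  have hterm : ∀ j ∈ (Finset.univ : Finset (Fin 6)),
      HasLiftDerivBounds 0 (fun y => (Real.exp (-(2 * I.rate k j * t)) * I.cprev k j) • I.Gprev k j y)
        (|Real.exp (-(2 * I.rate k j * t)) * I.cprev k j| * (4 * (I.cst.Camp 0 * I.N k) ^ 2))
        (4 * ((derivProfileMassSup (Fin 3) 0 + I.cst.cχ 0) * I.N k)) :=
    fun j _ => (h.hasLiftDerivBounds_Gprev 0 k j).const_smul _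
  have hs := HasLiftDerivBounds.sum Finset.univ hterm (le_trans zero_le_one (h.one_le_freq 0 k))
  have hfun : I.Rbar k t = fun y => ∑ j ∈ Finset.univ, (Real.exp (-(2 * I.rate k j * t)) * I.cprev k j) • I.Gprev k j y := by
    funext y a b; simp [Rbar, Finset.sum_apply, Pi.smul_apply, smul_eq_mul]
  rw [hfun]; exact hs.isSmooth

/-- `Q̄(t)` is smooth in `x`. [folklore] -/
theorem isSmooth_Qbar (k : ℕ) (t : ℝ) : IsSmooth (I.Qbar k t) :=
  Torus.isSmooth_finset_sum _ fun j _ => (h.isSmooth_pressurePot_Gprev k j).smul _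

/-- **`Δv̄_{k-1}(t) = div ΔR̄_{k-1}(t) - ∇ΔQ̄_{k-1}(t)`.** [cite: CoiculescuPalasek2025, Prop. 4.1 (`F₂ = ∑ΔR̄_k`)] -/
theorem laplacian_cascadePrev (k : ℕ) (t : ℝ) (x : UnitAddTorus (Fin 3)) :
    Torus.laplacian (I.cascadePrev k t) x = tensorDiv (I.RbarLap k t) x - Torus.gradient (I.QbarLap k t) x := by
  have hG : ∀ j ∈ (Finset.univ : Finset (Fin 6)), IsSmooth (I.Gprev k j) := fun j _ => h.isSmooth_Gprev k j
  have hP : ∀ j ∈ (Finset.univ : Finset (Fin 6)), IsSmooth (pressurePot (I.Gprev k j)) := fun j _ => h.isSmooth_pressurePot_Gprev k j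
  have hR := h.isSmooth_Rbar k t
  have hQ := h.isSmooth_Qbar k t
  have hfun : I.cascadePrev k t = (tensorDiv (I.Rbar k t)) - (Torus.gradient (I.Qbar k t)) :=
    funext fun y => h.cascadePrev_eq k t y
  rw [hfun, laplacian_sub (isSmooth_tensorDiv hR) hQ.gradient, Pi.sub_apply, laplacian_tensorDiv hR, laplacian_gradient hQ]
  congr 1
  · congr 1
    funext y a b
    rw [show I.Rbar k t = fun y a b => ∑ j ∈ Finset.univ, (Real.exp (-(2 * I.rate k j * t)) * I.cprev k j) * I.Gprev k j y a b from rfl,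
      tensorLap_finset_sum_smul Finset.univ _ hG y a b]
    rfl
  · congr 1
    funext y
    rw [show I.Qbar k t = fun y => ∑ j ∈ Finset.univ, (Real.exp (-(2 * I.rate k j * t)) * I.cprev k j) • pressurePot (I.Gprev k j) y from by
        funext z; simp [Qbar, smul_eq_mul],
      laplacian_finset_sum_smul Finset.univ _ hP y]
    simp [QbarLap, smul_eq_mul]

/-- **The cancellation `∂ₜR̄_{k-1} + 𝒩_{k,1} = 0`** for the levels carrying a cascade partner (`k ≥ 1`):
`2 rate · cascadeCoeff = rate² A N⁻⁴`. [cite: CoiculescuPalasek2025, Prop. 4.1 ("`∂ₜR̄_k + 𝒩_{k+1,1}` identically vanishes")] -/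
theorem RbarDt_add_N1 (k : ℕ) (t : ℝ) (x : UnitAddTorus (Fin 3)) (a b : Fin 3) :
    I.RbarDt (k + 1) t x a b + I.N1 (k + 1) t x a b = 0 := by
  simp only [RbarDt, N1, cprev, Gprev, ampSqTensor_eq_selfTensor, ← Finset.sum_add_distrib]
  refine Finset.sum_eq_zero fun j _ => ?_
  have hN : (I.N (k + 1) : ℝ) ≠ 0 := (h.N_pos' (k + 1)).ne'
  simp only [cascadeCoeff, rate]
  field_simp
  ring

/-- **`div (∂ₜR̄_{k-1}(t) + 𝒩_{k,1}(t)) = 0` for every `k`** (for `k ≥ 1` the tensor vanishes; for `k = 0` it is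
the constant tensor `𝒩_{0,1}(t)`, "annihilated by `div`"). [cite: CoiculescuPalasek2025, Prop. 4.1 (`F₃ = 0`)] -/
theorem tensorDiv_RbarDt_add_N1 (k : ℕ) (t : ℝ) (x : UnitAddTorus (Fin 3)) :
    tensorDiv (fun y a b => I.RbarDt k t y a b + I.N1 k t y a b) x = 0 := by
  -- in both cases the tensor is constant in `y`
  have hconst : ∃ T : Fin 3 → Fin 3 → ℝ, (fun y a b => I.RbarDt k t y a b + I.N1 k t y a b) = fun _ => T := by
    cases k with
    | zero =>
      refine ⟨fun a b => I.N1 0 t x a b, funext fun y => funext fun a => funext fun b => ?_⟩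
      rw [I.RbarDt_zero, zero_add]
      simp only [N1]
      exact Finset.sum_congr rfl fun j _ => by rw [I.selfTensor_zero_const j y x a b]
    | succ k =>
      exact ⟨fun _ _ => 0, funext fun y => funext fun a => funext fun b => h.RbarDt_add_N1 k t y a b⟩
  obtain ⟨T, hT⟩ := hconst
  rw [hT]
  ext i
  simp [tensorDiv_apply, Torus.partialDeriv_const_apply]

end Admissible

end IterData

end CP25

end Literature.Analysis.FluidPDE
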